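import Mathlib

/-!
# `TateLifting` (stmt-KontsevichZagierPeriods-9129), line `Sketch` — stub 44, THE ROTATION ENGINE: the chart

Auxiliary file (no definitions, theorems only) for `Theorems/InverseLandauTateLiftingRotationEngine.lean`.
On `ℝⁿ⁺²` we write a vector as `x = (v, y, z) = Fin.snoc (Fin.snoc v y) z` (`v ∈ ℝⁿ` the spectators,
`(y, z)` the rotated pair) and use the TAN-HALF-ANGLE parametrisation of the circle,
`cos = (1 − u²)/(1 + u²)`, `sin = 2u/(1 + u²)`. Contents:

* `snoc`/`init` bookkeeping for `(v, y, z)`;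
* the half-angle functions: Pythagoras, injectivity, derivatives, the Wronskian `cos·sin′ − cos′·sin = 2/(1+u²)`,
  and surjectivity onto the circle minus `(−1, 0)` (`u = z/(ρ + y)`);
* the planar chart `(ρ, u) ↦ (cos(u) ρ, sin(u) ρ)`: derivative and Jacobian determinant `2ρ/(1+u²)`;
* `exists_rotationChart` / `tateLifting_rotationEngineChart`: the chart
  `Φ(v, ρ, u) = (v, cos(u) ρ, sin(u) ρ)` of `ℝⁿ⁺²` EXISTS as an everywhere differentiable map with a
  derivative `Φ′(w)` of determinant `2ρ/(1+u²)` (constructed as `id × planar chart` conjugated by the linear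
  identification `ℝⁿ × ℝ² ≃ ℝⁿ⁺²`, determinant by `LinearMap.det_conj` / `LinearMap.det_prodMap`).

References: folklore calculus (the rational parametrisation of the circle); M. Kontsevich, D. Zagier,
*Periods* (2001), §1.2 rule (2) for the use made of it.
-/

noncomputable section

open Set

namespace Summit.KontsevichZagierPeriods.InverseLandau

namespace RotationEngine

variable {n : ℕ}

/-! ## `snoc`/`init` bookkeeping on `ℝⁿ⁺² = ℝⁿ × ℝ × ℝ` -/

/-- Spectators of `(v, y, z)`. [folklore] -/
@[simp] theorem init_init_snoc_snoc (v : Fin n → ℝ) (y z : ℝ) :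
    (Fin.init (Fin.init (Fin.snoc (Fin.snoc v y : Fin (n + 1) → ℝ) z : Fin (n + 2) → ℝ) :
      Fin (n + 1) → ℝ) : Fin n → ℝ) = v := by
  simp

/-- `y`-coordinate of `(v, y, z)`. [folklore] -/
@[simp] theorem init_snoc_snoc_last (v : Fin n → ℝ) (y z : ℝ) :
    (Fin.init (Fin.snoc (Fin.snoc v y : Fin (n + 1) → ℝ) z : Fin (n + 2) → ℝ) : Fin (n + 1) → ℝ)
      (Fin.last n) = y := by
  simp

/-- `z`-coordinate of `(v, y, z)`. [folklore] -/
@[simp] theorem snoc_snoc_last (v : Fin n → ℝ) (y z : ℝ) :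
    (Fin.snoc (Fin.snoc v y : Fin (n + 1) → ℝ) z : Fin (n + 2) → ℝ) (Fin.last (n + 1)) = z := by
  simp

/-- A vector is `(v, y, z)` with its own coordinates. [folklore] -/
@[simp] theorem snoc_snoc_init (x : Fin (n + 2) → ℝ) :
    (Fin.snoc (Fin.snoc (Fin.init (Fin.init x : Fin (n + 1) → ℝ) : Fin n → ℝ)
        ((Fin.init x : Fin (n + 1) → ℝ) (Fin.last n)) : Fin (n + 1) → ℝ) (x (Fin.last (n + 1))) :
      Fin (n + 2) → ℝ) = x := by
  simp [Fin.snoc_init_self]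

/-- `(v, y, z)` determines `v`, `y`, `z`. [folklore] -/
theorem snoc_snoc_inj {v v' : Fin n → ℝ} {y y' z z' : ℝ}
    (h : (Fin.snoc (Fin.snoc v y : Fin (n + 1) → ℝ) z : Fin (n + 2) → ℝ) =
      Fin.snoc (Fin.snoc v' y' : Fin (n + 1) → ℝ) z') :
    v = v' ∧ y = y' ∧ z = z' := by
  have h1 := congrArg (fun x : Fin (n + 2) → ℝ =>
    (Fin.init (Fin.init x : Fin (n + 1) → ℝ) : Fin n → ℝ)) h
  have h2 := congrArg (fun x : Fin (n + 2) → ℝ => (Fin.init x : Fin (n + 1) → ℝ) (Fin.last n)) h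
  have h3 := congrArg (fun x : Fin (n + 2) → ℝ => x (Fin.last (n + 1))) h
  simp only [init_init_snoc_snoc, init_snoc_snoc_last, snoc_snoc_last] at h1 h2 h3
  exact ⟨h1, h2, h3⟩

/-- The axis point `(v, ρ, 0)` of `w = (v, ρ, u)`. [folklore] -/
theorem snoc_init_zero_eq (w : Fin (n + 2) → ℝ) :
    (Fin.snoc (Fin.init w : Fin (n + 1) → ℝ) 0 : Fin (n + 2) → ℝ) =
      Fin.snoc (Fin.snoc (Fin.init (Fin.init w : Fin (n + 1) → ℝ) : Fin n → ℝ)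
        ((Fin.init w : Fin (n + 1) → ℝ) (Fin.last n)) : Fin (n + 1) → ℝ) 0 := by
  simp only [Fin.snoc_init_self]

/-! ## The tan-half-angle functions `cos = (1 − u²)/(1 + u²)`, `sin = 2u/(1 + u²)` -/

/-! Pythagoras `cos² + sin² = 1` for this parametrisation is the landed
`Summit.KontsevichZagierPeriods.KontsevichZagierPeriods.Theorems.ratCircle_sq_add_sq`. -/

/-- `1 + cos = 2/(1+u²)`: the chart misses only the angle `π`. [folklore] -/
theorem one_add_halfAngleCos (u : ℝ) : 1 + (1 - u ^ 2) / (1 + u ^ 2) = 2 / (1 + u ^ 2) := by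
  have h : (1 : ℝ) + u ^ 2 ≠ 0 := by positivity
  field_simp
  ring

/-- The half-angle formula `u = sin / (1 + cos)`. [folklore] -/
theorem halfAngle_eq (u : ℝ) : (2 * u / (1 + u ^ 2)) / (1 + (1 - u ^ 2) / (1 + u ^ 2)) = u := by
  rw [one_add_halfAngleCos]
  have h : (1 : ℝ) + u ^ 2 ≠ 0 := by positivity
  field_simp

/-- The half-angle parametrisation is injective. [folklore] -/
theorem halfAngle_inj {u u' : ℝ} (hc : (1 - u ^ 2) / (1 + u ^ 2) = (1 - u' ^ 2) / (1 + u' ^ 2))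
    (hs : 2 * u / (1 + u ^ 2) = 2 * u' / (1 + u' ^ 2)) : u = u' := by
  rw [← halfAngle_eq u, ← halfAngle_eq u', hc, hs]

/-- Derivative of `cos`. [folklore] -/
theorem hasDerivAt_halfAngleCos (u : ℝ) :
    HasDerivAt (fun u : ℝ => (1 - u ^ 2) / (1 + u ^ 2)) (-(4 * u) / (1 + u ^ 2) ^ 2) u := by
  have h1 : HasDerivAt (fun u : ℝ => 1 - u ^ 2) (-(2 * u)) u := by
    simpa using (hasDerivAt_pow 2 u).const_sub 1
  have h2 : HasDerivAt (fun u : ℝ => 1 + u ^ 2) (2 * u) u := by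
    simpa using (hasDerivAt_pow 2 u).const_add 1
  have h0 : (1 : ℝ) + u ^ 2 ≠ 0 := by positivity
  refine (h1.div h2 h0).congr_deriv ?_
  field_simp
  ring

/-- Derivative of `sin`. [folklore] -/
theorem hasDerivAt_halfAngleSin (u : ℝ) :
    HasDerivAt (fun u : ℝ => 2 * u / (1 + u ^ 2)) (2 * (1 - u ^ 2) / (1 + u ^ 2) ^ 2) u := by
  have h1 : HasDerivAt (fun u : ℝ => 2 * u) 2 u := by
    simpa using (hasDerivAt_id u).const_mul 2
  have h2 : HasDerivAt (fun u : ℝ => 1 + u ^ 2) (2 * u) u := by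
    simpa using (hasDerivAt_pow 2 u).const_add 1
  have h0 : (1 : ℝ) + u ^ 2 ≠ 0 := by positivity
  refine (h1.div h2 h0).congr_deriv ?_
  field_simp
  ring

/-- The Wronskian of the parametrisation: `cos · sin′ − cos′ · sin = 2/(1+u²)`. [folklore] -/
theorem halfAngle_wronskian (u : ℝ) :
    (1 - u ^ 2) / (1 + u ^ 2) * (2 * (1 - u ^ 2) / (1 + u ^ 2) ^ 2) -
        -(4 * u) / (1 + u ^ 2) ^ 2 * (2 * u / (1 + u ^ 2)) = 2 / (1 + u ^ 2) := by
  have h0 : (1 : ℝ) + u ^ 2 ≠ 0 := by positivity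
  field_simp
  ring

/-- **The half-angle of a point off the non-positive axis.** For `(y, z)` with `z ≠ 0 ∨ y > 0` put
`ρ = √(y² + z²)` and `u = z/(ρ + y)`; then `ρ > 0`, `cos(u)·ρ = y`, `sin(u)·ρ = z`. [folklore] -/
theorem halfAngle_surj {y z : ℝ} (h : z ≠ 0 ∨ 0 < y) :
    0 < Real.sqrt (y ^ 2 + z ^ 2) ∧
      (1 - (z / (Real.sqrt (y ^ 2 + z ^ 2) + y)) ^ 2) / (1 + (z / (Real.sqrt (y ^ 2 + z ^ 2) + y)) ^ 2) *
          Real.sqrt (y ^ 2 + z ^ 2) = y ∧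
      2 * (z / (Real.sqrt (y ^ 2 + z ^ 2) + y)) / (1 + (z / (Real.sqrt (y ^ 2 + z ^ 2) + y)) ^ 2) *
          Real.sqrt (y ^ 2 + z ^ 2) = z := by
  set ρ := Real.sqrt (y ^ 2 + z ^ 2) with hρ
  have hρ2 : ρ ^ 2 = y ^ 2 + z ^ 2 := by
    rw [hρ, Real.sq_sqrt (by positivity)]
  have hpos : 0 < ρ + y := by
    rcases h with hz | hy
    · have : |y| < ρ := by
        rw [hρ, ← Real.sqrt_sq_eq_abs]
        apply Real.sqrt_lt_sqrt (sq_nonneg _)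
        have : 0 < z ^ 2 := by positivity
        linarith
      have := neg_abs_le y
      linarith
    · have hyρ : |y| ≤ ρ := by
        rw [hρ, ← Real.sqrt_sq_eq_abs]
        exact Real.sqrt_le_sqrt (by nlinarith [sq_nonneg z])
      linarith [abs_nonneg y, le_abs_self y]
  have hρpos : 0 < ρ := by
    rcases h with hz | hy
    · rw [hρ]; apply Real.sqrt_pos.2; positivity
    · rw [hρ]; apply Real.sqrt_pos.2; positivity
  have hne : ρ + y ≠ 0 := hpos.ne'
  have h1 : (1 : ℝ) + (z / (ρ + y)) ^ 2 = 2 * ρ / (ρ + y) := by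
    field_simp
    nlinarith [hρ2]
  refine ⟨hρpos, ?_, ?_⟩
  · have h2 : (1 : ℝ) - (z / (ρ + y)) ^ 2 = 2 * y / (ρ + y) := by
      field_simp
      nlinarith [hρ2]
    rw [h1, h2]
    field_simp
  · rw [h1]
    field_simp

/-! ## The planar chart `(ρ, u) ↦ (cos(u) ρ, sin(u) ρ)` -/

/-- The determinant of the continuous linear map of a `2 × 2` matrix is the determinant of the matrix.
[folklore] -/
theorem det_toContinuousLinearMap_toLin' (M : Matrix (Fin 2) (Fin 2) ℝ) :
    (LinearMap.toContinuousLinearMap (Matrix.toLin' M)).det = M.det := by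
  show LinearMap.det (Matrix.toLin' M) = _
  rw [LinearMap.det_toLin']

/-- **Jacobian determinant of the planar chart**: `det = 2ρ/(1+u²)`. [folklore] -/
theorem det_planarChart (ρ u : ℝ) :
    (LinearMap.toContinuousLinearMap (Matrix.toLin'
      !![(1 - u ^ 2) / (1 + u ^ 2), -(4 * u) / (1 + u ^ 2) ^ 2 * ρ;
         2 * u / (1 + u ^ 2), 2 * (1 - u ^ 2) / (1 + u ^ 2) ^ 2 * ρ])).det = 2 * ρ / (1 + u ^ 2) := by
  rw [det_toContinuousLinearMap_toLin', Matrix.det_fin_two_of]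
  have h := halfAngle_wronskian u
  calc (1 - u ^ 2) / (1 + u ^ 2) * (2 * (1 - u ^ 2) / (1 + u ^ 2) ^ 2 * ρ) -
        -(4 * u) / (1 + u ^ 2) ^ 2 * ρ * (2 * u / (1 + u ^ 2))
      = ((1 - u ^ 2) / (1 + u ^ 2) * (2 * (1 - u ^ 2) / (1 + u ^ 2) ^ 2) -
          -(4 * u) / (1 + u ^ 2) ^ 2 * (2 * u / (1 + u ^ 2))) * ρ := by ring
    _ = 2 / (1 + u ^ 2) * ρ := by rw [h]
    _ = 2 * ρ / (1 + u ^ 2) := by ring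

/-- **The planar chart is differentiable** with the displayed Jacobian (coordinates `p 0 = ρ`,
`p 1 = u`). [folklore] -/
theorem hasFDerivAt_planarChart (p : Fin 2 → ℝ) :
    HasFDerivAt (fun p : Fin 2 → ℝ => (![(1 - p 1 ^ 2) / (1 + p 1 ^ 2) * p 0, 2 * p 1 / (1 + p 1 ^ 2) * p 0] :
        Fin 2 → ℝ))
      (LinearMap.toContinuousLinearMap (Matrix.toLin'
        !![(1 - p 1 ^ 2) / (1 + p 1 ^ 2), -(4 * p 1) / (1 + p 1 ^ 2) ^ 2 * p 0;
           2 * p 1 / (1 + p 1 ^ 2), 2 * (1 - p 1 ^ 2) / (1 + p 1 ^ 2) ^ 2 * p 0])) p := by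
  rw [hasFDerivAt_pi']
  have h0 : HasFDerivAt (fun q : Fin 2 → ℝ => q 0)
      (ContinuousLinearMap.proj (R := ℝ) (φ := fun _ : Fin 2 => ℝ) 0) p := hasFDerivAt_apply 0 p
  have h1 : HasFDerivAt (fun q : Fin 2 → ℝ => q 1)
      (ContinuousLinearMap.proj (R := ℝ) (φ := fun _ : Fin 2 => ℝ) 1) p := hasFDerivAt_apply 1 p
  have hc := (hasDerivAt_halfAngleCos (p 1)).comp_hasFDerivAt p h1
  have hs := (hasDerivAt_halfAngleSin (p 1)).comp_hasFDerivAt p h1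
  intro i
  fin_cases i
  · refine ((hc.mul h0).congr_fderiv (ContinuousLinearMap.ext fun v => ?_)).congr_of_eventuallyEq
      (Filter.Eventually.of_forall fun q => ?_)
    · simp [Matrix.toLin'_apply, dotProduct, Fin.sum_univ_two]
      ring
    · simp
  · refine ((hs.mul h0).congr_fderiv (ContinuousLinearMap.ext fun v => ?_)).congr_of_eventuallyEq
      (Filter.Eventually.of_forall fun q => ?_)
    · simp [Matrix.toLin'_apply, dotProduct, Fin.sum_univ_two]
      ring
    · simp

/-! ## The chart of `ℝⁿ⁺²` -/

/-- **THE ROTATION CHART EXISTS.** There are a map `Φ` of `ℝⁿ⁺²` and a field of continuous linear maps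
`Φ′` with: `Φ(v, ρ, u) = (v, cos(u) ρ, sin(u) ρ)` in the tan-half-angle parametrisation, `Φ` has derivative
`Φ′(w)` at every `w`, and `det Φ′(w) = 2ρ/(1+u²)`. Construction: `Φ = e ∘ (id × g) ∘ e⁻¹` for the linear
identification `e : ℝⁿ × ℝ² ≃ ℝⁿ⁺²`, `(v, p) ↦ (v, p 0, p 1)`, and the planar chart `g`; the determinant is
`det (id × g′) = det g′`. [folklore] -/
theorem exists_rotationChart (n : ℕ) :
    ∃ (Φ : (Fin (n + 2) → ℝ) → (Fin (n + 2) → ℝ))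
      (Φ' : (Fin (n + 2) → ℝ) → (Fin (n + 2) → ℝ) →L[ℝ] (Fin (n + 2) → ℝ)),
      (∀ w, Φ w = Fin.snoc (Fin.snoc (Fin.init (Fin.init w : Fin (n + 1) → ℝ) : Fin n → ℝ)
          ((1 - w (Fin.last (n + 1)) ^ 2) / (1 + w (Fin.last (n + 1)) ^ 2) *
            (Fin.init w : Fin (n + 1) → ℝ) (Fin.last n)) : Fin (n + 1) → ℝ)
          (2 * w (Fin.last (n + 1)) / (1 + w (Fin.last (n + 1)) ^ 2) *
            (Fin.init w : Fin (n + 1) → ℝ) (Fin.last n))) ∧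
      (∀ w, HasFDerivAt Φ (Φ' w) w) ∧
      ∀ w, (Φ' w).det =
        2 * (Fin.init w : Fin (n + 1) → ℝ) (Fin.last n) / (1 + w (Fin.last (n + 1)) ^ 2) := by
  -- the linear identification `ℝⁿ × ℝ² ≃ ℝⁿ⁺²`
  let e : ((Fin n → ℝ) × (Fin 2 → ℝ)) ≃ₗ[ℝ] (Fin (n + 2) → ℝ) :=
    { toFun := fun q => Fin.snoc (Fin.snoc q.1 (q.2 0) : Fin (n + 1) → ℝ) (q.2 1)
      invFun := fun x => ((Fin.init (Fin.init x : Fin (n + 1) → ℝ) : Fin n → ℝ),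
        ![(Fin.init x : Fin (n + 1) → ℝ) (Fin.last n), x (Fin.last (n + 1))])
      map_add' := fun q q' => by
        ext i
        refine Fin.lastCases ?_ (fun i => ?_) i
        · simp
        · refine Fin.lastCases ?_ (fun i => ?_) i
          · simp
          · simp
      map_smul' := fun c q => by
        ext i
        refine Fin.lastCases ?_ (fun i => ?_) i
        · simp
        · refine Fin.lastCases ?_ (fun i => ?_) i
          · simp
          · simp
      left_inv := fun q => by
        ext i
        · simp
        · fin_cases i <;> simp
      right_inv := fun x => by simp [Fin.snoc_init_self] }
  let eL : ((Fin n → ℝ) × (Fin 2 → ℝ)) ≃L[ℝ] (Fin (n + 2) → ℝ) := e.toContinuousLinearEquiv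
  -- the planar chart and its Jacobian
  let g : (Fin 2 → ℝ) → (Fin 2 → ℝ) := fun p =>
    ![(1 - p 1 ^ 2) / (1 + p 1 ^ 2) * p 0, 2 * p 1 / (1 + p 1 ^ 2) * p 0]
  let g' : (Fin 2 → ℝ) → (Fin 2 → ℝ) →L[ℝ] (Fin 2 → ℝ) := fun p =>
    LinearMap.toContinuousLinearMap (Matrix.toLin'
      !![(1 - p 1 ^ 2) / (1 + p 1 ^ 2), -(4 * p 1) / (1 + p 1 ^ 2) ^ 2 * p 0;
         2 * p 1 / (1 + p 1 ^ 2), 2 * (1 - p 1 ^ 2) / (1 + p 1 ^ 2) ^ 2 * p 0])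
  have heL : ∀ q, eL q = Fin.snoc (Fin.snoc q.1 (q.2 0) : Fin (n + 1) → ℝ) (q.2 1) := fun q => rfl
  have heL_symm : ∀ x, eL.symm x = ((Fin.init (Fin.init x : Fin (n + 1) → ℝ) : Fin n → ℝ),
      ![(Fin.init x : Fin (n + 1) → ℝ) (Fin.last n), x (Fin.last (n + 1))]) := fun x => rfl
  refine ⟨eL ∘ Prod.map id g ∘ eL.symm, fun w =>
    ContinuousLinearMap.comp (eL : ((Fin n → ℝ) × (Fin 2 → ℝ)) →L[ℝ] (Fin (n + 2) → ℝ))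
      (ContinuousLinearMap.comp ((ContinuousLinearMap.id ℝ (Fin n → ℝ)).prodMap (g' (eL.symm w).2))
        (eL.symm : (Fin (n + 2) → ℝ) →L[ℝ] ((Fin n → ℝ) × (Fin 2 → ℝ)))), ?_, ?_, ?_⟩
  · intro w
    simp [heL, heL_symm, g]
  · intro w
    have h1 : HasFDerivAt (eL.symm : (Fin (n + 2) → ℝ) → (Fin n → ℝ) × (Fin 2 → ℝ))
        (eL.symm : (Fin (n + 2) → ℝ) →L[ℝ] ((Fin n → ℝ) × (Fin 2 → ℝ))) w := eL.symm.hasFDerivAt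
    have h2 : HasFDerivAt (Prod.map id g)
        ((ContinuousLinearMap.id ℝ (Fin n → ℝ)).prodMap (g' (eL.symm w).2)) (eL.symm w) :=
      HasFDerivAt.prodMap (eL.symm w) (hasFDerivAt_id _) (hasFDerivAt_planarChart _)
    have h3 : HasFDerivAt (eL : ((Fin n → ℝ) × (Fin 2 → ℝ)) → (Fin (n + 2) → ℝ))
        (eL : ((Fin n → ℝ) × (Fin 2 → ℝ)) →L[ℝ] (Fin (n + 2) → ℝ)) (Prod.map id g (eL.symm w)) :=
      eL.hasFDerivAt
    exact h3.comp w (h2.comp w h1)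
  · intro w
    have hcoe : ((ContinuousLinearMap.comp (eL : ((Fin n → ℝ) × (Fin 2 → ℝ)) →L[ℝ] (Fin (n + 2) → ℝ))
        (ContinuousLinearMap.comp ((ContinuousLinearMap.id ℝ (Fin n → ℝ)).prodMap (g' (eL.symm w).2))
          (eL.symm : (Fin (n + 2) → ℝ) →L[ℝ] ((Fin n → ℝ) × (Fin 2 → ℝ)))) :
          (Fin (n + 2) → ℝ) →L[ℝ] (Fin (n + 2) → ℝ)) : (Fin (n + 2) → ℝ) →ₗ[ℝ] (Fin (n + 2) → ℝ)) =
      ((e : ((Fin n → ℝ) × (Fin 2 → ℝ)) →ₗ[ℝ] (Fin (n + 2) → ℝ)) ∘ₗ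
        (((LinearMap.id : (Fin n → ℝ) →ₗ[ℝ] (Fin n → ℝ)).prodMap
          ((g' (eL.symm w).2 : (Fin 2 → ℝ) →L[ℝ] (Fin 2 → ℝ)) : (Fin 2 → ℝ) →ₗ[ℝ] (Fin 2 → ℝ))) ∘ₗ
        (e.symm : (Fin (n + 2) → ℝ) →ₗ[ℝ] ((Fin n → ℝ) × (Fin 2 → ℝ))))) :=
      LinearMap.ext fun v => rfl
    change LinearMap.det _ = _
    rw [hcoe, LinearMap.det_conj, LinearMap.det_prodMap, LinearMap.det_id, one_mul]
    change (g' (eL.symm w).2).det = _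
    rw [heL_symm]
    simp only [g', Matrix.cons_val_one, Matrix.cons_val_zero]
    exact det_planarChart _ _

/-- **The rotation chart and its Jacobian** (registered auxiliary statement of stub 44 of the line
`Sketch`; same as `RotationEngine.exists_rotationChart`): the tan-half-angle chart
`Φ(v, ρ, u) = (v, ρ(1−u²)/(1+u²), 2ρu/(1+u²))` of `ℝⁿ⁺²` exists as an everywhere differentiable map with a
derivative of determinant `2ρ/(1+u²)` (`ρ = w_n`, `u = w_{n+1}`). [folklore] -/
theorem _root_.Summit.KontsevichZagierPeriods.InverseLandau.tateLifting_rotationEngineChart :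
    ∀ n : ℕ, ∃ (Φ : (Fin (n + 2) → ℝ) → (Fin (n + 2) → ℝ))
      (Φ' : (Fin (n + 2) → ℝ) → (Fin (n + 2) → ℝ) →L[ℝ] (Fin (n + 2) → ℝ)),
      (∀ w, Φ w = Fin.snoc (Fin.snoc (Fin.init (Fin.init w : Fin (n + 1) → ℝ) : Fin n → ℝ)
          ((1 - w (Fin.last (n + 1)) ^ 2) / (1 + w (Fin.last (n + 1)) ^ 2) *
            (Fin.init w : Fin (n + 1) → ℝ) (Fin.last n)) : Fin (n + 1) → ℝ)
          (2 * w (Fin.last (n + 1)) / (1 + w (Fin.last (n + 1)) ^ 2) *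
            (Fin.init w : Fin (n + 1) → ℝ) (Fin.last n))) ∧
      (∀ w, HasFDerivAt Φ (Φ' w) w) ∧
      ∀ w, (Φ' w).det =
        2 * (Fin.init w : Fin (n + 1) → ℝ) (Fin.last n) / (1 + w (Fin.last (n + 1)) ^ 2) :=
  exists_rotationChart

end RotationEngine

end Summit.KontsevichZagierPeriods.InverseLandau
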